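import Literature.MathematicalPhysics.QuantumFieldTheory.Balaban1983to89.B12FaddeevPopov016TwoLevel
import Literature.MathematicalPhysics.QuantumFieldTheory.Balaban1983to89.B16ZLowerCompactGroup

/-!
# `Balaban1983to89.B12FaddeevPopov016ClosedSubgroup` — [Balaban1987RG1] (0.16) p. 255 for the concrete averaged contour
# variables (0.11) on EVERY compact gauge group presented in `U(N)`, in particular on every closed subgroup `G ≤ U(N)`:
# the side condition «z ≠ 0» of (0.15) DISCHARGED at print's generality «G ⊂ U(N) a Lie subgroup» (not only `U(N)`, `SU(N)`)

statement-level skeleton of published theorems with citation tags; proofs where landed; nothing here is a claim about the Yang–Mills mass gap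

Unit `lit-balaban-p24` gen 10 (Phase-2 proof seat, free-target protocol G.5-34(d), own Lie lane; rider to gen 9's
`HaarSmallBallClosedSubgroup` / `B16ZLowerCompactGroup`).  SKELETON rows served (support cells, NO head change): B12.Eq0.16
(owner r09/r20; decl of record `B12FaddeevPopov016.FP016` / `fp016_of_fineInvariant`, concrete contour variables
`B12FaddeevPopov016TwoLevel`), B12.Eq0.15 (z).

CITATION HEADER.  T. Bałaban, *Renormalization group approach to lattice gauge field theories. I*, Commun. Math. Phys. **109**
(1987) 249–301 [Balaban1987RG1] (cell paper B12; held `paper:balaban1987-cmp109-rg-i-small-field`, journal page = PDF page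
+ 248), p. 255, verbatim (as quoted in `B12FaddeevPopov016TwoLevel`): *«We introduce (0.15) under the integral in (0.13) and
we apply the usual Faddeev-Popov procedure … Thus we get (Tρ)(V) = ∫dU t(V,U) Π_{y∈T⁽¹⁾} Π_{x∈B(y),x≠y} (1/z) exp[−(1/α)[1 −
Re tr U(y,x)]] χ({|U(y,x) − 1| < ε₀}) ρ(U). (0.16)»* with p. 255 l. 1 *«where z is defined by the last integral»* of (0.15)
p. 254, and the standing generality pp. 251–252 *«G is … a Lie subgroup of a group of complex unitary matrices, for example
G ⊂ U(N)»*.  Haar small balls: [VaropoulosSaloffcosteCoulhon1993] Thm. V.4.1 (tree: gen 9 `haar_ball_ge_of_unitaryRep`).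

WHAT THIS MODULE PROVES (theorems only; no definition, no named fact, no `sorry`; axioms standard).
`B12FaddeevPopov016TwoLevel.fp016_contourData` proves (0.16) for the concrete (0.11) contour data over any regular gauge
group, leaving `z ≠ 0`; that file discharges it on `U(N)` and `SU(N)` from the N-uniform small-ball bounds.  Here:
* §1 `zNorm_pos_of_unitaryRep` — **`z(α, ε₀) > 0` for EVERY compact gauge group presented in `U(N)`** by a continuous unitary
  `ρ` with `dist1 = ‖ρ· − 1‖`, `reTr = Re Tr ρ·/N` (gen 9's Laplace bound `zNorm_ge_of_unitaryRep` on the ball of radius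
  `ε₀/2` + the Haar small-ball bound `haarReal_repBall_ge` with the exponent `dim 𝔤`); `fp016_contourData_of_unitaryRep` —
  (0.16) for such `G` with NO residual side condition beyond the printed hypotheses and the measurability of `M`.
* §2 `zNorm_closedSubgroup_pos`, **`fp016_contourData_closedSubgroup`** — the same for EVERY closed subgroup `G ≤ U(N)` with
  the cell's canonical structures (`GaugeGroup.ofUnitaryRep` of the inclusion, `HaarData.ofCompactGroup`; gen 9
  `B16ZLowerCompactGroup` §4), hypothesis-free in the group.
HONEST SCOPE: the constant is not explicit (finite subcover), unlike the `U(N)`/`SU(N)` instances; nothing else of the paper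
is asserted; row heads unchanged.
-/

noncomputable section

open _root_.MeasureTheory
open scoped Matrix.Norms.L2Operator

namespace Literature.MathematicalPhysics.QuantumFieldTheory.Balaban1983to89.B12FaddeevPopov016ClosedSubgroup

open BlockAveragingTwoLevel B12FaddeevPopov016 B12FaddeevPopov016TwoLevel UnitaryModel
open B16ZLowerCompactGroup (zNorm_ge_of_unitaryRep haarReal_repBall_ge regularGaugeGroup_ofUnitaryRep
  secondCountableTopology_closedSubgroup)
open HaarSmallBallClosedSubgroup (compactSpace_of_isClosed_subgroup)
open Literature.MathematicalPhysics.QuantumLattice (matrixLieAlgebra unitaryFundamentalRep)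

/-! ## §1 `z > 0` and (0.16) on every compact gauge group presented in `U(N)` -/

section General

variable {n : Type*} [Fintype n] [DecidableEq n] [Nonempty n]
variable {G : Type*} [GaugeGroup G] [MeasurableSpace G] [RegularGaugeGroup G] [HaarData G]
  [TopologicalSpace G] [IsTopologicalGroup G] [CompactSpace G] [BorelSpace G]
variable (ρ : G →* Matrix n n ℂ) (hρc : Continuous ρ) (hρu : ∀ g, ρ g ∈ Matrix.unitaryGroup n ℂ)
  (hdist : ∀ g : G, dist1 g = ‖ρ g - 1‖) (hre : ∀ g : G, reTr g = nReTr (ρ g))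

include hρc hρu hdist hre in
/-- **`z(α, ε₀) > 0` ON EVERY COMPACT GAUGE GROUP PRESENTED IN `U(N)`** («where z is defined by the last integral» of (0.15)):
`z ≥ e^{−ε₀²/(8α)}·Haar{‖ρ g − 1‖ ≤ ε₀/2} ≥ e^{−ε₀²/(8α)}·c·(ε₀/2)^{dim 𝔤} > 0`.
[cite: Balaban1987RG1, (0.15) p.254; VaropoulosSaloffcosteCoulhon1993, Thm. V.4.1] -/
theorem zNorm_pos_of_unitaryRep {α ε₀ : ℝ} (hα : 0 < α) (hε : 0 < ε₀) : 0 < B16ZLower.zNorm G α ε₀ := by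
  have hε2 : 0 < ε₀ / 2 := half_pos hε
  obtain ⟨c, hc, -, hball⟩ := haarReal_repBall_ge ρ hρc hρu hε2
  have hb := hball (ε₀ / 2) hε2 le_rfl
  have hz := zNorm_ge_of_unitaryRep ρ hρc hρu hdist hre hα (half_lt_self hε)
  have hpos : 0 < Real.exp (-((ε₀ / 2) ^ 2 / 2 / α)) *
      (HaarData.haar : Measure G).real {g : G | ‖ρ g - 1‖ ≤ ε₀ / 2} :=
    mul_pos (Real.exp_pos _) (lt_of_lt_of_le (by positivity) hb)
  exact lt_of_lt_of_le hpos hz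

include hρc hρu hdist hre in
/-- **(0.16) ON EVERY COMPACT GAUGE GROUP PRESENTED IN `U(N)`** for the concrete contour variables (0.11): no residual side
condition beyond the printed hypotheses (kernel invariant under `u` with `u = 1` on `T⁽¹⁾`; `α > 0`, `ε₀ > 0`) and the
measurability of the group average `M` at each arity. [cite: Balaban1987RG1, (0.16) p.255] -/
theorem fp016_contourData_of_unitaryRep {P : Params} {j : ℕ} (hj : j + 1 ≤ P.m + P.K) (k : KernelRT P j G)
    (hk : k.FineInvariant) (𝓜 : GroupAverage G) (hM : ∀ m, Measurable (fun W : Fin (m + 1) → G => 𝓜.M W))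
    {α ε₀ : ℝ} (hα : 0 < α) (hε : 0 < ε₀) : FP016 k (contourData 𝓜) α ε₀ :=
  fp016_contourData hj k hk 𝓜 hM hα (zNorm_pos_of_unitaryRep ρ hρc hρu hdist hre hα hε).ne'

end General

/-! ## §2 Every closed subgroup `G ≤ U(N)` with the cell's canonical structures -/

section ClosedSubgroup

variable {N : ℕ} [NeZero N]

/-- **`z > 0` on every closed subgroup `G ≤ U(N)`** with `GaugeGroup.ofUnitaryRep` of the inclusion and the normalised Haar
measure `HaarData.ofCompactGroup` (as in gen 9 `B16ZLowerCompactGroup.zLower_closedSubgroup`).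
[cite: Balaban1987RG1, (0.15) p.254] -/
theorem zNorm_closedSubgroup_pos (Gs : Subgroup (Matrix.unitaryGroup (Fin N) ℂ))
    (hGs : IsClosed (Gs : Set (Matrix.unitaryGroup (Fin N) ℂ))) {α ε₀ : ℝ} (hα : 0 < α) (hε : 0 < ε₀) :
    letI : GaugeGroup Gs := GaugeGroup.ofUnitaryRep Gs ((unitaryFundamentalRep (Fin N) ℂ).comp Gs.subtype)
      (fun g => (g : Matrix.unitaryGroup (Fin N) ℂ).2)
    letI : CompactSpace Gs := compactSpace_of_isClosed_subgroup Gs hGs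
    letI : HaarData Gs := HaarData.ofCompactGroup Gs
    0 < B16ZLower.zNorm Gs α ε₀ := by
  set ρ : Gs →* Matrix (Fin N) (Fin N) ℂ := (unitaryFundamentalRep (Fin N) ℂ).comp Gs.subtype with hρdef
  have hρu : ∀ g : Gs, ρ g ∈ Matrix.unitaryGroup (Fin N) ℂ := fun g => (g : Matrix.unitaryGroup (Fin N) ℂ).2
  letI : GaugeGroup Gs := GaugeGroup.ofUnitaryRep Gs ρ hρu
  letI : CompactSpace Gs := compactSpace_of_isClosed_subgroup Gs hGs
  haveI : SecondCountableTopology Gs := secondCountableTopology_closedSubgroup Gs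
  have hρc : Continuous ρ := continuous_subtype_val.comp continuous_subtype_val
  haveI : RegularGaugeGroup Gs := regularGaugeGroup_ofUnitaryRep ρ hρc hρu
  letI : HaarData Gs := HaarData.ofCompactGroup Gs
  exact zNorm_pos_of_unitaryRep (G := Gs) ρ hρc hρu (fun _ => rfl) (fun _ => rfl) hα hε

/-- **(0.16) ON EVERY CLOSED SUBGROUP `G ≤ U(N)`** for the concrete contour variables (0.11), with the cell's canonical
structures on `G` — print's «G ⊂ U(N) a Lie subgroup» served for ALL closed `G`, the side condition `z ≠ 0` discharged;
only the printed hypotheses (fine-gauge-invariant kernel, `α > 0`, `ε₀ > 0`) and the measurability of `M` remain.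
[cite: Balaban1987RG1, (0.16) p.255] -/
theorem fp016_contourData_closedSubgroup (Gs : Subgroup (Matrix.unitaryGroup (Fin N) ℂ))
    (hGs : IsClosed (Gs : Set (Matrix.unitaryGroup (Fin N) ℂ))) {P : Params} {j : ℕ} (hj : j + 1 ≤ P.m + P.K)
    {α ε₀ : ℝ} (hα : 0 < α) (hε : 0 < ε₀) :
    letI : GaugeGroup Gs := GaugeGroup.ofUnitaryRep Gs ((unitaryFundamentalRep (Fin N) ℂ).comp Gs.subtype)
      (fun g => (g : Matrix.unitaryGroup (Fin N) ℂ).2)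
    letI : CompactSpace Gs := compactSpace_of_isClosed_subgroup Gs hGs
    letI : HaarData Gs := HaarData.ofCompactGroup Gs
    ∀ (k : KernelRT P j Gs), k.FineInvariant → ∀ (𝓜 : GroupAverage Gs),
      (∀ m, Measurable (fun W : Fin (m + 1) → Gs => 𝓜.M W)) → FP016 k (contourData 𝓜) α ε₀ := by
  set ρ : Gs →* Matrix (Fin N) (Fin N) ℂ := (unitaryFundamentalRep (Fin N) ℂ).comp Gs.subtype with hρdef
  have hρu : ∀ g : Gs, ρ g ∈ Matrix.unitaryGroup (Fin N) ℂ := fun g => (g : Matrix.unitaryGroup (Fin N) ℂ).2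
  letI : GaugeGroup Gs := GaugeGroup.ofUnitaryRep Gs ρ hρu
  letI : CompactSpace Gs := compactSpace_of_isClosed_subgroup Gs hGs
  haveI : SecondCountableTopology Gs := secondCountableTopology_closedSubgroup Gs
  have hρc : Continuous ρ := continuous_subtype_val.comp continuous_subtype_val
  haveI : RegularGaugeGroup Gs := regularGaugeGroup_ofUnitaryRep ρ hρc hρu
  letI : HaarData Gs := HaarData.ofCompactGroup Gs
  intro k hk 𝓜 hM
  exact fp016_contourData_of_unitaryRep (G := Gs) ρ hρc hρu (fun _ => rfl) (fun _ => rfl) hj k hk 𝓜 hM hα hε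

end ClosedSubgroup

end Literature.MathematicalPhysics.QuantumFieldTheory.Balaban1983to89.B12FaddeevPopov016ClosedSubgroup

end
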